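import Summits.CriticalPhenomena.PercolationContinuityZ3.Theorems.PercNearOneGluingNoHeavyLowerTailKnQuestion8CoefficientwiseQmixRootEdgeClasses
import HarnessLib

/-!
# The two-point exclusion at a point with a ROOT EDGE, part 2: the wall class sum minus its blue-joined part, and the separation corollaries — prim-lf-2 gen 51 (part 2 of 3)

Support file (`--supports stmt-CriticalPhenomena-4575`, closed), prover `prim-lf-2` (gen 51).  No definitions, no named facts, no sorries; standard axioms.
Memo `prim-lf-2/CW-ROOTEDGE-gen51.md` §2; part 1 is `…CoefficientwiseQmixRootEdgeClasses.lean` (the two unsigned `u`-star classes of `Q_mix(p,q)[1_u,g]` for `N(u) = {p,q,x}` are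
bounded below by the ROOT-DOM wall sums `WC_R(p) = Σ_r [p ∉ a r][p ∉ b r]·(g(a r) − g(b r))`, `a(r) = K(r⁺ ∪ R)`, `b(r) = K((rᶜ)⁺ ∪ (D∖R))`).
* `wallClass_ge_blueJoined_part` — for a class whose red edges go to `x` and `q` and whose blue edges go to `p`:
  `WC_R(p) ≥ Σ_r [p ∉ a r][p ∉ b r][p ∈ C_q((rᶜ)⁺)]·(g(a r) − g(b r))` — the event `{p ∉ a r, p ∉ b r, p ∉ C_q((rᶜ)⁺)}` is closed under `r ↦ rᶜ` and `b(r) ⊆ a(rᶜ)`, so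
  that part is `Σ [·](g(a rᶜ) − g(b r)) ≥ 0` termwise (this is prim-lf-2 gen 25's reduction ROOT-DOM ⟸ DOM-C, kernel-checked; the remaining blue-joined sum is gen 25's DOM-C
  functional, census-clean and open in general);
* `wallClass_nonneg_of_sep` — if every open `q–p` connection among the edges off the star of `u` joins `q` to `x`, the blue-joined part is empty and `WC_R(p) ≥ 0` for EVERY
  monotone `g`;
* `wallClass_pointIndicator_nonneg_of_sep` — if every such connection joins `q` to `x` or to `w`, then `WC_R(p)[1_w] ≥ 0` (on the blue-joined part `w ∉ b(r)`).
Part 3 (`…QmixRootEdgeMain.lean`) assembles: `Q_mix(p,q)[1_u,g] ≥ 0` / NO-CORE at the degree-two `y` for `N(u) = {p,q,x}` under these separations — the 6-vertex residue of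
CONJECTURE NO-CORE for the points (prim-lf-2 CW-TWOSOURCE-gen50 §1.3) without a `p–q` edge.  Exact checks (prim-lf-2 code/gen51 wallq_t2.c, kit51a): the blue-joined part itself is
`≥ 0` for all monotone `g` on all graphs with ≤ 6 vertices and all 7-vertex graphs with ≤ 7 edges (0 negatives) — CONJECTURE ROOT-DOM territory.
[cite: KozmaNitzan2024, Questions 8–9 (§5.5 p. 36) (context: the Question-8 pocket covariance programme)]
-/

namespace Summit.CriticalPhenomena.PercolationContinuityZ3.Theorems

open Finset Literature.Probability.Percolation

namespace Coefficientwise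

variable {ι V : Type*} [Fintype ι] [DecidableEq ι] (ends : ι → Sym2 V) (x : V)

section rootClassWall

variable {u p q : V} (D R : Finset ι)

open Classical in
/-- **The wall class sum minus its blue-joined part is nonnegative (gen 25's DOM-C reduction, kernel form).**  Let `D` be ALL edges at `u`, `R ⊆ D`, every edge of `R` with
ends `{u,x}` or `{u,q}` — among them `eₓ` (`{u,x}`) and `e_q` (`{u,q}`) — and every edge of `D ∖ R` with ends `{u,p}`; `x, p, q ≠ u`.  With `a(r) = K(r⁺ ∪ R)`,
`b(r) = K((rᶜ)⁺ ∪ (D∖R))` and `C_q((rᶜ)⁺)` the blue cluster of `q` among the edges off `D`, for every monotone `g`: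
`Σ_r [p ∉ a r][p ∉ b r][p ∈ C_q((rᶜ)⁺)]·(g(a r) − g(b r)) ≤ Σ_r [p ∉ a r][p ∉ b r]·(g(a r) − g(b r))`.
(The event `{p ∉ a r, p ∉ b r, p ∉ C_q((rᶜ)⁺)}` is closed under `r ↦ rᶜ` and `b(r) ⊆ a(rᶜ)`, so that part is `Σ [·](g(a rᶜ) − g(b r)) ≥ 0`.)
[cite: KozmaNitzan2024, Questions 8–9 (§5.5 p. 36) (context)] -/
theorem wallClass_ge_blueJoined_part (hdeg : ∀ i, u ∈ ends i → i ∈ D)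
    {eₓ : ι} (heₓ : ends eₓ = s(u, x)) (heₓR : eₓ ∈ R) (hxu : x ≠ u)
    {e_q : ι} (he_q : ends e_q = s(u, q)) (he_qR : e_q ∈ R) (hqu : q ≠ u)
    (hRends : ∀ i ∈ R, ends i = s(u, x) ∨ ends i = s(u, q))
    (hP : ∀ i ∈ D \ R, ends i = s(u, p)) (hpu : p ≠ u)
    (g : Set V → ℝ) (hg : Monotone g) :
    ∑ r : Finset {j : ι // j ∉ D},
      (if (p ∉ openCluster (ends '' (↑(r.map (Function.Embedding.subtype _) ∪ R) : Set ι)) x ∧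
            p ∉ openCluster (ends '' (↑(rᶜ.map (Function.Embedding.subtype _) ∪ (D \ R)) : Set ι)) x ∧
            p ∈ openCluster (ends '' (↑(rᶜ.map (Function.Embedding.subtype _)) : Set ι)) q) then
        (g (openCluster (ends '' (↑(r.map (Function.Embedding.subtype _) ∪ R) : Set ι)) x) -
          g (openCluster (ends '' (↑(rᶜ.map (Function.Embedding.subtype _) ∪ (D \ R)) : Set ι)) x))
      else 0) ≤
    ∑ r : Finset {j : ι // j ∉ D},
      (if (p ∉ openCluster (ends '' (↑(r.map (Function.Embedding.subtype _) ∪ R) : Set ι)) x ∧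
            p ∉ openCluster (ends '' (↑(rᶜ.map (Function.Embedding.subtype _) ∪ (D \ R)) : Set ι)) x) then
        (g (openCluster (ends '' (↑(r.map (Function.Embedding.subtype _) ∪ R) : Set ι)) x) -
          g (openCluster (ends '' (↑(rᶜ.map (Function.Embedding.subtype _) ∪ (D \ R)) : Set ι)) x))
      else 0) := by
  set emb := Function.Embedding.subtype (fun j : ι => j ∉ D) with hemb
  set a : Finset {j : ι // j ∉ D} → Set V := fun r => openCluster (ends '' (↑(r.map emb ∪ R) : Set ι)) x with ha
  set a' : Finset {j : ι // j ∉ D} → Set V := fun r => openCluster (ends '' (↑(r.map emb ∪ (D \ R)) : Set ι)) x with ha'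
  set K₀ : Finset {j : ι // j ∉ D} → Set V := fun r => openCluster (ends '' (↑(r.map emb) : Set ι)) x with hK₀
  set Bq : Finset {j : ι // j ∉ D} → Set V := fun r => openCluster (ends '' (↑(rᶜ.map emb) : Set ι)) q with hBq
  change ∑ r : Finset {j : ι // j ∉ D}, (if (p ∉ a r ∧ p ∉ a' rᶜ ∧ p ∈ Bq r) then (g (a r) - g (a' rᶜ)) else 0) ≤
    ∑ r : Finset {j : ι // j ∉ D}, (if (p ∉ a r ∧ p ∉ a' rᶜ) then (g (a r) - g (a' rᶜ)) else 0)
  -- ties and inclusions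
  have hua : ∀ r, u ∈ a r := fun r =>
    (mem_openCluster_iff_of_edge ends x (r.map emb ∪ R) heₓ hxu (Finset.mem_union_right _ heₓR)).mpr (mem_openCluster_self _ x)
  have hqa : ∀ r, q ∈ a r := fun r =>
    (mem_openCluster_iff_of_edge ends x (r.map emb ∪ R) he_q hqu (Finset.mem_union_right _ he_qR)).mp (hua r)
  have hT : ∀ (t : Finset {j : ι // j ∉ D}), ∀ i ∈ t.map emb, u ∉ ends i := by
    intro t i hi hui
    obtain ⟨hiD, _⟩ := (mem_map_subtype_iff (fun j : ι => j ∉ D) t i).mp hi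
    exact hiD (hdeg i hui)
  have sub1 : ∀ t : Finset {j : ι // j ∉ D}, a' t ⊆ a t := by
    intro t v hv
    rcases openCluster_union_pendantStar_subset ends x (t.map emb) (D \ R) (hT t) hP hxu v hv with rfl | hv'
    · exact hua t
    · exact openCluster_image_mono ends Finset.subset_union_left x hv'
  have hK₀a' : ∀ t : Finset {j : ι // j ∉ D}, K₀ t ⊆ a' t := fun t =>
    openCluster_image_mono ends Finset.subset_union_left x
  -- `a(t)` is contained in `K₀(t) ∪ {u} ∪ C_q(t⁺)` (the red edges at `u` lead to `x` and `q` only)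
  have hconf : ∀ t : Finset {j : ι // j ∉ D}, ∀ v ∈ a t, v ∈ K₀ t ∨ v = u ∨ v ∈ openCluster (ends '' (↑(t.map emb) : Set ι)) q := by
    intro t
    set W : Set V := {v | v ∈ K₀ t ∨ v = u ∨ v ∈ openCluster (ends '' (↑(t.map emb) : Set ι)) q} with hW
    have hxW : x ∈ W := Or.inl (mem_openCluster_self _ x)
    have hcl : ∀ c ∈ W, ∀ d, (openGraph (ends '' (↑(t.map emb ∪ R) : Set ι))).Adj c d → d ∈ W := by
      intro c hc d hcd
      rw [openGraph_image_adj] at hcd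
      obtain ⟨⟨i, hi, hicd⟩, hne⟩ := hcd
      rcases Finset.mem_union.mp hi with hit | hiR
      · -- an edge off `D`: clusters are closed, and it avoids `u`
        have hadjx : (openGraph (ends '' (↑(t.map emb) : Set ι))).Adj c d := by
          rw [openGraph_image_adj]; exact ⟨⟨i, hit, hicd⟩, hne⟩
        rcases hc with hc | rfl | hc
        · exact Or.inl (SimpleGraph.Reachable.trans hc hadjx.reachable)
        · exfalso; apply hT t i hit; rw [hicd]; exact Sym2.mem_mk_left _ _
        · exact Or.inr (Or.inr (SimpleGraph.Reachable.trans hc hadjx.reachable))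
      · -- a red edge at `u`: ends `{u,x}` or `{u,q}`
        rcases hRends i hiR with hix | hiq
        · have hcd' : s(c, d) = s(u, x) := by rw [← hicd, hix]
          rcases Sym2.eq_iff.mp hcd' with ⟨_, hd⟩ | ⟨_, hd⟩
          · rw [hd]; exact Or.inl (mem_openCluster_self _ x)
          · rw [hd]; exact Or.inr (Or.inl rfl)
        · have hcd' : s(c, d) = s(u, q) := by rw [← hicd, hiq]
          rcases Sym2.eq_iff.mp hcd' with ⟨_, hd⟩ | ⟨_, hd⟩
          · rw [hd]; exact Or.inr (Or.inr (mem_openCluster_self _ q))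
          · rw [hd]; exact Or.inr (Or.inl rfl)
    intro v hv
    exact openCluster_subset_of_adjClosed ends x (↑(t.map emb ∪ R) : Set ι) W hxW hcl hv
  -- the complement-closed event
  have hinv : ∀ r : Finset {j : ι // j ∉ D}, (p ∉ a r ∧ p ∉ a' rᶜ ∧ p ∉ Bq r) → (p ∉ a rᶜ ∧ p ∉ a' rᶜᶜ ∧ p ∉ Bq rᶜ) := by
    rintro r ⟨h1, h2, h3⟩
    refine ⟨?_, ?_, ?_⟩
    · intro hp
      rcases hconf rᶜ p hp with h | h | h
      · exact h2 (hK₀a' rᶜ h)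
      · exact hpu h
      · exact h3 h
    · rw [compl_compl]; exact fun hp => h1 (sub1 r hp)
    · intro hp
      simp only [hBq, compl_compl] at hp
      -- `p` joined to `q` off `D`, and `q ∈ a r`: then `p ∈ a r`
      have hqp : p ∈ openCluster (ends '' (↑(r.map emb ∪ R) : Set ι)) q :=
        openCluster_image_mono ends Finset.subset_union_left q hp
      exact h1 (SimpleGraph.Reachable.trans (hqa r) hqp)
  have hiff : ∀ r : Finset {j : ι // j ∉ D}, (p ∉ a r ∧ p ∉ a' rᶜ ∧ p ∉ Bq r) ↔ (p ∉ a rᶜ ∧ p ∉ a' rᶜᶜ ∧ p ∉ Bq rᶜ) := by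
    intro r
    refine ⟨hinv r, fun h => ?_⟩
    have := hinv rᶜ h
    simpa only [compl_compl] using this
  -- split the wall sum
  have hsplit : ∀ r : Finset {j : ι // j ∉ D}, (if (p ∉ a r ∧ p ∉ a' rᶜ) then (g (a r) - g (a' rᶜ)) else 0) =
      (if (p ∉ a r ∧ p ∉ a' rᶜ ∧ p ∈ Bq r) then (g (a r) - g (a' rᶜ)) else 0) +
      (if (p ∉ a r ∧ p ∉ a' rᶜ ∧ p ∉ Bq r) then (g (a r) - g (a' rᶜ)) else 0) := by
    intro r
    by_cases h1 : p ∈ a r <;> by_cases h2 : p ∈ a' rᶜ <;> by_cases h3 : p ∈ Bq r <;> simp [h1, h2, h3]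
  rw [Finset.sum_congr rfl (fun r _ => hsplit r), Finset.sum_add_distrib]
  -- the complement-closed part: reindex the `g(a r)` half by `r ↦ rᶜ`
  have hre : ∑ r : Finset {j : ι // j ∉ D}, (if (p ∉ a r ∧ p ∉ a' rᶜ ∧ p ∉ Bq r) then (g (a r) - g (a' rᶜ)) else 0) =
      ∑ r : Finset {j : ι // j ∉ D}, (if (p ∉ a r ∧ p ∉ a' rᶜ ∧ p ∉ Bq r) then (g (a rᶜ) - g (a' rᶜ)) else 0) := by
    have e1 : ∑ r : Finset {j : ι // j ∉ D}, (if (p ∉ a r ∧ p ∉ a' rᶜ ∧ p ∉ Bq r) then g (a r) else 0) =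
        ∑ r : Finset {j : ι // j ∉ D}, (if (p ∉ a r ∧ p ∉ a' rᶜ ∧ p ∉ Bq r) then g (a rᶜ) else 0) := by
      rw [← sum_compl_eq (fun r : Finset {j : ι // j ∉ D} => (if (p ∉ a r ∧ p ∉ a' rᶜ ∧ p ∉ Bq r) then g (a r) else 0))]
      refine Finset.sum_congr rfl fun r _ => ?_
      by_cases h : p ∉ a r ∧ p ∉ a' rᶜ ∧ p ∉ Bq r
      · have h' := (hiff r).mp h
        rw [if_pos h, if_pos h']
      · have h' : ¬ (p ∉ a rᶜ ∧ p ∉ a' rᶜᶜ ∧ p ∉ Bq rᶜ) := fun hh => h ((hiff r).mpr hh)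
        rw [if_neg h, if_neg h']
    have e2 : ∀ (G : Finset {j : ι // j ∉ D} → ℝ), ∑ r : Finset {j : ι // j ∉ D}, (if (p ∉ a r ∧ p ∉ a' rᶜ ∧ p ∉ Bq r) then (G r - g (a' rᶜ)) else 0) =
        ∑ r : Finset {j : ι // j ∉ D}, (if (p ∉ a r ∧ p ∉ a' rᶜ ∧ p ∉ Bq r) then G r else 0) -
        ∑ r : Finset {j : ι // j ∉ D}, (if (p ∉ a r ∧ p ∉ a' rᶜ ∧ p ∉ Bq r) then g (a' rᶜ) else 0) := by
      intro G
      rw [← Finset.sum_sub_distrib]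
      refine Finset.sum_congr rfl fun r _ => ?_
      split_ifs <;> simp
    rw [e2 (fun r => g (a r)), e2 (fun r => g (a rᶜ)), e1]
  rw [hre]
  have hnonneg : 0 ≤ ∑ r : Finset {j : ι // j ∉ D}, (if (p ∉ a r ∧ p ∉ a' rᶜ ∧ p ∉ Bq r) then (g (a rᶜ) - g (a' rᶜ)) else 0) := by
    refine Finset.sum_nonneg fun r _ => ?_
    split_ifs
    · have := hg (sub1 rᶜ); linarith
    · exact le_refl _
  linarith

open Classical in
/-- **COROLLARY: the wall class sum is nonnegative when `x` separates `q` from `p` off the star of `u`.**  In the setting of `wallClass_ge_blueJoined_part`, if every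
open `q–p` connection among the edges off `D` also joins `q` to `x` (`hsep`), then `WC_R(p) = Σ_r [p ∉ a r][p ∉ b r]·(g(a r) − g(b r)) ≥ 0` for EVERY monotone `g`
(the blue-joined part is empty: `p ∈ C_q`, `x ∈ C_q` would put `p ∈ K((rᶜ)⁺) ⊆ b(r)`).  [cite: KozmaNitzan2024, Questions 8–9 (§5.5 p. 36) (context)] -/
theorem wallClass_nonneg_of_sep (hdeg : ∀ i, u ∈ ends i → i ∈ D)
    {eₓ : ι} (heₓ : ends eₓ = s(u, x)) (heₓR : eₓ ∈ R) (hxu : x ≠ u)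
    {e_q : ι} (he_q : ends e_q = s(u, q)) (he_qR : e_q ∈ R) (hqu : q ≠ u)
    (hRends : ∀ i ∈ R, ends i = s(u, x) ∨ ends i = s(u, q))
    (hP : ∀ i ∈ D \ R, ends i = s(u, p)) (hpu : p ≠ u)
    (hsep : ∀ s : Finset ι, (∀ i ∈ s, i ∉ D) → p ∈ openCluster (ends '' (↑s : Set ι)) q → x ∈ openCluster (ends '' (↑s : Set ι)) q)
    (g : Set V → ℝ) (hg : Monotone g) :
    0 ≤ ∑ r : Finset {j : ι // j ∉ D},
      (if (p ∉ openCluster (ends '' (↑(r.map (Function.Embedding.subtype _) ∪ R) : Set ι)) x ∧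
            p ∉ openCluster (ends '' (↑(rᶜ.map (Function.Embedding.subtype _) ∪ (D \ R)) : Set ι)) x) then
        (g (openCluster (ends '' (↑(r.map (Function.Embedding.subtype _) ∪ R) : Set ι)) x) -
          g (openCluster (ends '' (↑(rᶜ.map (Function.Embedding.subtype _) ∪ (D \ R)) : Set ι)) x))
      else 0) := by
  have key := wallClass_ge_blueJoined_part ends x D R hdeg heₓ heₓR hxu he_q he_qR hqu hRends hP hpu g hg
  refine le_trans (le_of_eq ?_) key
  symm
  refine Finset.sum_eq_zero fun r _ => ?_
  set emb := Function.Embedding.subtype (fun j : ι => j ∉ D) with hemb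
  split_ifs with h
  · exfalso
    obtain ⟨_, h2, h3⟩ := h
    have hoff : ∀ i ∈ rᶜ.map emb, i ∉ D := fun i hi => ((mem_map_subtype_iff (fun j : ι => j ∉ D) rᶜ i).mp hi).1
    have hxq := hsep (rᶜ.map emb) hoff h3
    -- `p ∈ C_x((rᶜ)⁺) ⊆ b(r)`
    have hpx : p ∈ openCluster (ends '' (↑(rᶜ.map emb) : Set ι)) x :=
      SimpleGraph.Reachable.trans (SimpleGraph.Reachable.symm hxq) h3
    exact h2 (openCluster_image_mono ends Finset.subset_union_left x hpx)
  · rfl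

open Classical in
/-- **COROLLARY (point functions): the wall class sum of `1_w` is nonnegative when `{x, w}` separates `q` from `p` off the star of `u`.**  In the setting of
`wallClass_ge_blueJoined_part`, let `w ≠ u` and suppose every open `q–p` connection among the edges off `D` joins `q` to `x` or to `w` (`hsep`).  Then
`WC_R(p)[1_w] = Σ_r [p ∉ a r][p ∉ b r]·([w ∈ a r] − [w ∈ b r]) ≥ 0`: on the blue-joined part `w ∉ b(r)` (else `x ∈ C_q((rᶜ)⁺)` and `p ∈ b(r)`), so its summands are
`[w ∈ a r] ≥ 0`.  This settles, via part 2, the 6-vertex residue shapes of CONJECTURE NO-CORE for the points that have no `p–q` edge.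
[cite: KozmaNitzan2024, Questions 8–9 (§5.5 p. 36) (context)] -/
theorem wallClass_pointIndicator_nonneg_of_sep (hdeg : ∀ i, u ∈ ends i → i ∈ D)
    {eₓ : ι} (heₓ : ends eₓ = s(u, x)) (heₓR : eₓ ∈ R) (hxu : x ≠ u)
    {e_q : ι} (he_q : ends e_q = s(u, q)) (he_qR : e_q ∈ R) (hqu : q ≠ u)
    (hRends : ∀ i ∈ R, ends i = s(u, x) ∨ ends i = s(u, q))
    (hP : ∀ i ∈ D \ R, ends i = s(u, p)) (hpu : p ≠ u) {w : V} (hwu : w ≠ u)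
    (hsep : ∀ s : Finset ι, (∀ i ∈ s, i ∉ D) → p ∈ openCluster (ends '' (↑s : Set ι)) q →
      x ∈ openCluster (ends '' (↑s : Set ι)) q ∨ w ∈ openCluster (ends '' (↑s : Set ι)) q) :
    0 ≤ ∑ r : Finset {j : ι // j ∉ D},
      (if (p ∉ openCluster (ends '' (↑(r.map (Function.Embedding.subtype _) ∪ R) : Set ι)) x ∧
            p ∉ openCluster (ends '' (↑(rᶜ.map (Function.Embedding.subtype _) ∪ (D \ R)) : Set ι)) x) then
        ((if w ∈ openCluster (ends '' (↑(r.map (Function.Embedding.subtype _) ∪ R) : Set ι)) x then (1 : ℝ) else 0) -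
          (if w ∈ openCluster (ends '' (↑(rᶜ.map (Function.Embedding.subtype _) ∪ (D \ R)) : Set ι)) x then (1 : ℝ) else 0))
      else 0) := by
  have hgm : Monotone (fun C : Set V => if w ∈ C then (1 : ℝ) else 0) := fun A B hAB => by
    by_cases hA : w ∈ A
    · simp [hA, hAB hA]
    · simp only [hA, if_false]; split_ifs <;> norm_num
  have key := wallClass_ge_blueJoined_part ends x D R hdeg heₓ heₓR hxu he_q he_qR hqu hRends hP hpu
    (fun C : Set V => if w ∈ C then (1 : ℝ) else 0) hgm
  refine le_trans ?_ key
  refine Finset.sum_nonneg fun r _ => ?_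
  set emb := Function.Embedding.subtype (fun j : ι => j ∉ D) with hemb
  split_ifs with h h1 h2 <;> try norm_num
  -- the only remaining case: `w ∉ a(r)` but `w ∈ b(r)` on the blue-joined event — impossible
  exfalso
  obtain ⟨_, hp2, hp3⟩ := h
  have hoff : ∀ i ∈ rᶜ.map emb, i ∉ D := fun i hi => ((mem_map_subtype_iff (fun j : ι => j ∉ D) rᶜ i).mp hi).1
  have hT : ∀ i ∈ rᶜ.map emb, u ∉ ends i := fun i hi hui => (hoff i hi) (hdeg i hui)
  rcases openCluster_union_pendantStar_subset ends x (rᶜ.map emb) (D \ R) hT hP hxu w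
    ‹w ∈ openCluster (ends '' (↑(rᶜ.map emb ∪ (D \ R)) : Set ι)) x› with hw' | hw'
  · exact hwu hw'
  · -- `x ~ w` off `D`; with `q ~ p` off `D` and the separation, `x ~ q`, hence `p ∈ K((rᶜ)⁺) ⊆ b(r)`
    have hxq : x ∈ openCluster (ends '' (↑(rᶜ.map emb) : Set ι)) q := by
      rcases hsep (rᶜ.map emb) hoff hp3 with hx | hwq
      · exact hx
      · exact SimpleGraph.Reachable.trans hwq (SimpleGraph.Reachable.symm hw')
    have hpx : p ∈ openCluster (ends '' (↑(rᶜ.map emb) : Set ι)) x :=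
      SimpleGraph.Reachable.trans (SimpleGraph.Reachable.symm hxq) hp3
    exact hp2 (openCluster_image_mono ends Finset.subset_union_left x hpx)

end rootClassWall

end Coefficientwise

end Summit.CriticalPhenomena.PercolationContinuityZ3.Theorems
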